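import Summits.QuantumFields.YangMills.Theorems.BalabanUVNodesN22W1RelCentredSliceInputsLGU
import Literature.MathematicalPhysics.QuantumFieldTheory.Balaban1983to89.B13TermWalkDataOneTorus

/-!
# BalabanUVNodes ∕ node N22 = NE9 — THE RELATIVE-DISC CENTRED ROAD OVER THE ADMISSIBLE CLASS, MODULE J13b: THE UNIFORM ∕ PRIMITIVE RECORD `SliceInputsLGU` AT ANY DATUM SLICE
# WITH FREE KERNELS AND VANISHING UNSCALED DATA — SMALL-FIELD LABELS (`P(t) = ∅`, boxes `≡ 1`, empty box support) — J12-Wb's construction with the inlined datum ABSTRACTED to nine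
# equations (module J13 reads ONE datum family at every slice through J13a ∕ J13b)

Cell `pub-ymgap`, HUMAN RULING D-0062 (Track A), R134 ACCELERATION re-seat `pub-ymgap-dag-n22-c` (strategy s1), generation 9, file J13b.  THEOREMS ONLY; imports J12-D
`…N22W1RelCentredSliceInputsLGU` (the uniform ∕ primitive record) and `B13TermWalkDataOneTorus` — SELF-CONTAINED w.r.t. its sibling J13a (the elementary rate fact is a private lemma here).  `--supports` K3⁷ `SpineGivenEndpointR13SepCoPH` (stmt-QuantumFields-20544) as a helper.

WHY.  The A6 witnesses J12-W ∕ J12-Wb inhabit the record TYPE `SliceInputsLGU` per slice, each with its OWN inlined degenerate datum (boxes `≡ 0` at a large-field label, `≡ 1` at a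
small-field one).  The knit J12-K, however, takes ONE datum FAMILY with ONE set of unscaled-field data for ALL slices and conjoins the unscaled-field law `hlaw` (ref-G g16 READ226
NOTE-1: «the JOINT antecedent with `hlaw` … is NOT witnessed»).  To witness that joint antecedent (module J13) one needs the record at a datum that is NOT chosen per slice.  THIS FILE
abstracts J12-Wb's construction accordingly: the inlined datum is replaced by ANY datum `𝔇` together with the nine `rfl`-type equations the construction actually uses at the slice `(Z, t)`
(`A(ψ,σ) = 1`, `G(σ, uOf ψ) = 0`, `Γ₀ = 0`, `C = 1`, row-fibre bound `m = 1`, `x ^ ν = 1`, `r = 1`, `|Λ| = 1`, `|Λ ⊕ C₀| = 1` — NODE A's free kernels on one row bond; W1-15's `free` and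
J13's label-boxed family have them by `rfl`), and ANY unscaled data that at this slice are the constants the construction uses (`χᵘ Z t = χᶜᵘ Z t = fun _ ↦ 1`, `𝒲 Z t φ Y = 0`,
`𝒪 Z t old φ Y = 0` as functions of the field).  Conclusion and letters VERBATIM J12-Wb's (every label with `P(t) = ∅`; `W := univ`, `ρb = 1∕100`, `a₅ = 1∕5`); proof = J12-Wb's with the twenty-four
box ∕ potential fields routed through the four equations (`simp only`).  GENERATED from J12-Wb by `gen/build_j13.py`.  Degenerate data; nothing of print's.

HONEST FRAMING.  An INHABITATION device for a HYPOTHESIS RECORD at degenerate data; asserts NOTHING of Bałaban's; does NOT inhabit the record at the datum OF RECORD; count-neutral;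
N22 NOT discharged; one finite four-torus programme at fixed ε — NOT infinite volume, NOT OS on ℝ⁴, NOT a mass gap, NOT Clay.  0 `sorry`, 0 `def`, standard axioms.

References (TYPES only): [II] = [Balaban1988RG2Cluster] (1.5) p. 3, (2.3) p. 12, (2.14) p. 15, (2.22) p. 16; [I] = [Balaban1987RG1] (2.9)–(2.13) pp. 266–268.
-/

noncomputable section

namespace YMDAG.N22.W1

open Set Metric Matrix
open scoped BigOperators
open Literature.MathematicalPhysics.QuantumFieldTheory.Balaban1983to89
open Literature.MathematicalPhysics.QuantumFieldTheory.Balaban1983to89.TreeLengthTorus (TPt TDom tsys torusTreeLen torusTreeLen_nonneg)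
open Literature.MathematicalPhysics.QuantumFieldTheory.Balaban1983to89.B13Bound143 (invTau invTau_pos)
open Literature.MathematicalPhysics.QuantumFieldTheory.Balaban1983to89.B9Thm37GlueTorus (tdist1 tdist1_self)
open Literature.MathematicalPhysics.QuantumFieldTheory.Balaban1983to89.B5TorusCover (UT)
open Literature.MathematicalPhysics.QuantumFieldTheory.Balaban1983to89.B13TermWalkDataOneTorus (freeKernels)
open Literature.MathematicalPhysics.QuantumFieldTheory.Balaban1983to89.B13Term214 (term214 core214 F214)
open Literature.MathematicalPhysics.QuantumFieldTheory.Balaban1983to89.Step (SFConsts)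
open Literature.MathematicalPhysics.QuantumFieldTheory.Balaban1983to89.Node00.Sect2 (domSys domCount CPair spaceI domSites Setting Residual)
open Literature.MathematicalPhysics.QuantumFieldTheory.Balaban1983to89.Node00.W1

variable (c : B13.Consts) (P : Params) (𝔸 : Type*) [NormedRing 𝔸] [NormedAlgebra ℂ 𝔸] [CompleteSpace 𝔸] (M k L : ℕ) [NeZero L]

/-- `exp (−max 0 (−log ε)) ≤ ε` for `ε > 0` (private copy of J10-W's `exp_neg_posLog_le`). [folklore] (elementary) -/
private theorem exp_neg_posLog_le' {ε : ℝ} (hε : 0 < ε) : Real.exp (-(max 0 (-Real.log ε))) ≤ ε := by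
  rcases le_or_gt 1 ε with h | h
  · have : max 0 (-Real.log ε) = 0 := max_eq_left (neg_nonpos.2 (Real.log_nonneg h))
    rw [this, neg_zero, Real.exp_zero]
    exact h
  · have : max 0 (-Real.log ε) = -Real.log ε := max_eq_right (neg_nonneg.2 (Real.log_nonpos hε.le h.le))
    rw [this, neg_neg, Real.exp_log hε]

/-! ## §1 The uniform record at any degenerate datum slice, small-field labels (`P(t) = ∅`) -/

open Classical in
/-- **★ THE UNIFORM RECORD AT ANY DEGENERATE DATUM SLICE, EVERY LABEL WITH `P(t) = ∅`** — for a datum `𝔇` whose kernel record at `(Z, t)` satisfies the nine free-kernel equations and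
unscaled data that are the constants `χᵘ Z t = χᶜᵘ Z t ≡ 1`, `𝒲 Z t ≡ 0`, `𝒪 Z t ≡ 0` at this slice: `SliceInputsLGU 𝔇 χᵘ χᶜᵘ 𝒲 𝒪 c Sg Rz cs E₀ κ_E Z t univ s₀ a (1∕5) (1∕100) Mv` is
inhabited, for every tables, size letters, weight letter `a`, base point `s₀ > 0`, `Mv > 1` and constants record `c` with `κ₁ ≥ 1` and W1-8's `0 < invTau c d ≤ ½` — J12-Wb's letters and field
proofs VERBATIM, the box ∕ potential fields through the four slice equations.  Degenerate data; nothing of print's.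
[cite: Balaban1987RG1, (2.9)-(2.13) pp.266-268; Balaban1988RG2Cluster, (2.3) p.12, (2.14) p.15 and (2.22) p.16 (degenerate data; bookkeeping)] -/
theorem sliceInputsLGU_of_degenerate_smallField (hκ₁ : 1 ≤ c.κ₁) (hinv : ∀ d : ℝ, 0 ≤ d → 0 < invTau c d ∧ invTau c d ≤ 1 / 2)
    {G : Type*} [GaugeGroup G] (Sg : Setting 𝔸 G) (Rz : Residual P 𝔸) (cs : SFConsts) (E₀ κE : ℝ)
    (Z : (domSys P M (k + 1)).Dom) (hZ : 1 ≤ (Z.1).card) (t : TermLabel P M k L) (hP : t.2 = ∅)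
    {s₀ Mv : ℝ} (hs₀ : 0 < s₀) (hMv : 1 < Mv) (a : ℝ)
    (𝔇 : TermDatum214 c P 𝔸 M k L)
    (χu χcu : (Z : (domSys P M (k + 1)).Dom) → (t : TermLabel P M k L) → ((𝔇.𝒦 Z t).Λ → ℝ) → ℝ)
    (𝒲 : (Z : (domSys P M (k + 1)).Dom) → (t : TermLabel P M k L) → CPair P 𝔸 → TDom P.d (L * domCount P M (k + 1)) → ((𝔇.𝒦 Z t).Λ → ℝ) → ℂ)
    (𝒪 : (Z : (domSys P M (k + 1)).Dom) → (t : TermLabel P M k L) → OlderTerms P 𝔸 M k → CPair P 𝔸 → TDom P.d (L * domCount P M (k + 1)) →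
      ((𝔇.𝒦 Z t).Λ → ℝ) → ℂ)
    -- THE DEGENERACY OF THE DATUM AT THIS SLICE (NODE A's free kernels on one row bond, Cauchy radius 1, zero-dimensional site torus — W1-15's `free` has them by `rfl`)
    (hA1 : ∀ (ψ : CPair P 𝔸) (σ : TPt P.d (domCount P M (k + 1)) → ℂ), 𝔇.A Z t ψ σ = 1)
    (hG0 : ∀ (σ : TPt P.d (domCount P M (k + 1)) → ℂ) (ψ : CPair P 𝔸), (𝔇.𝒦 Z t).G2 σ (𝔇.uOf Z t ψ) = 0)
    (hΓ0 : (𝔇.𝒦 Z t).Γ₀ = 0) (hC1 : (𝔇.𝒦 Z t).C = 1) (hm : (𝔇.𝒦 Z t).m = 1) (hpow : ∀ x : ℝ, x ^ 𝔇.ν = 1) (hr1 : 𝔇.r = 1)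
    (hcardΛ : Fintype.card (𝔇.𝒦 Z t).Λ = 1) (hcardΛC : Fintype.card ((𝔇.𝒦 Z t).Λ ⊕ (𝔇.𝒦 Z t).C₀) = 1)
    -- THE UNSCALED-FIELD DATA AT THIS SLICE: boxes constant (`≡ 1` at a small-field label, empty box support), zero potentials
    (hχ : χu Z t = fun _ => (1 : ℝ)) (hχc : χcu Z t = fun _ => (1 : ℝ))
    (h𝒲 : ∀ (φ : CPair P 𝔸) (Y : TDom P.d (L * domCount P M (k + 1))), 𝒲 Z t φ Y = fun _ => 0)
    (h𝒪 : ∀ (old : OlderTerms P 𝔸 M k) (φ : CPair P 𝔸) (Y : TDom P.d (L * domCount P M (k + 1))), 𝒪 Z t old φ Y = fun _ => 0) :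
    Nonempty (SliceInputsLGU 𝔇 χu χcu 𝒲 𝒪 c Sg Rz cs E₀ κE Z t Set.univ s₀ a (1 / 5) (1 / 100) Mv) := by
  have hP0 : t.2.card = 0 := by rw [hP, Finset.card_empty]
  have hGam : ∀ (ψ : CPair P 𝔸) (σ : TPt P.d (domCount P M (k + 1)) → ℂ) (X : (𝔇.𝒦 Z t).Λ ⊕ (𝔇.𝒦 Z t).C₀ → ℝ), 𝔇.Gam Z t ψ σ X = 0 := by
    intro ψ σ X; rw [TermDatum214.Gam, hG0, Matrix.zero_mulVec]
  -- W1-8's located τ-letters from the elementary conditions on `c`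
  have hposY : ∀ Y : TDom P.d (L * domCount P M (k + 1)), 0 < invTau c ((tsys P.d (L * domCount P M (k + 1))).dj Y) := fun Y =>
    (hinv _ (torusTreeLen_nonneg Y.1)).1
  have hhalfY : ∀ Y : TDom P.d (L * domCount P M (k + 1)), invTau c ((tsys P.d (L * domCount P M (k + 1))).dj Y) ≤ 1 / 2 := fun Y =>
    (hinv _ (torusTreeLen_nonneg Y.1)).2
  -- the box radius from the box-tail rate
  set y : ℝ := max 0 (-Real.log ((Mv - 1) * s₀ ^ 2)) with hy
  have hy0 : 0 ≤ y := le_max_left _ _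
  have hMv1 : 0 < Mv - 1 := sub_pos.2 hMv
  have hrate : Real.exp (-y) ≤ (Mv - 1) * s₀ ^ 2 := exp_neg_posLog_le' (by positivity)
  set rP : ℝ := Real.sqrt (100 * max a 0) with hrPdef
  set Rb : ℝ := Real.sqrt (200 * y) with hRbdef
  have hrPsq : rP ^ 2 = 100 * max a 0 := Real.sq_sqrt (by positivity)
  have hRbsq : Rb ^ 2 = 200 * y := Real.sq_sqrt (by positivity)
  have hA1' : ∀ ψ : CPair P 𝔸, 𝔇.A Z t ψ = fun _ => 1 := fun ψ => funext (hA1 ψ)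
  have hGam' : ∀ ψ : CPair P 𝔸, 𝔇.Gam Z t ψ = fun _ _ => 0 := fun ψ => funext fun σ => funext (hGam ψ σ)
  refine ⟨?_⟩
  exact
    { Uσ := univ,
      Uτ := fun Y => ball 0 ((invTau c ((tsys P.d (L * domCount P M (k + 1))).dj Y))⁻¹ + 3),
      γ₂ := 1 / 100,
      rP := rP,
      qP := fun B => B ⬝ᵥ B,
      kap := 3,
      kap' := 2,
      kap'' := 1,
      θ := 1 / 40,
      θE := 0,
      θΓ := 0,
      θC := 0,
      KG := 0,
      KΓ := 0,
      KCs := 1,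
      K₀ := 1,
      KE := 1,
      KG' := 0,
      KCs' := ((1 - 1 / 100) ^ 2)⁻¹,
      θΓ' := 0,
      θC' := 1 / 100 * (2 + 1 / 100) * ((1 - 1 / 100) ^ 2)⁻¹ * 1,
      θE' := 1 / 100 * (2 + 1 / 100),
      a' := 0,
      w' := 0,
      cE := 1,
      g := 0,
      Rb := Rb,
      κ := 1 / 100,
      a₀ := 0,
      w₀ := 0,
      T := Mv - 1,
      α₀ := 0,
      r₁ := 0,
      TP := 0,
      ac := 1 / 200,
      wc := 0,
      hpos := hposY,
      hhalf := hhalfY,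
      hW := isOpen_univ,
      hUσ := isOpen_univ,
      hUτ := fun _ => isOpen_ball,
      hUexp := subset_univ _,
      hUtau := fun Y => closedBall_subset_ball (by linarith),
      hr := by rw [hr1]; exact zero_lt_one,
      hr' := by rw [hr1]; linarith [Real.add_one_le_exp c.κ₁],
      hsubτ := by
        intro Y x hx w hw
        rw [Set.uIcc_of_le zero_le_one] at hx
        rw [mem_closedBall, hr1] at hw
        rw [mem_ball, dist_zero_right]
        have hx1 : ‖(x : ℂ)‖ ≤ 1 := by rw [Complex.norm_real, Real.norm_eq_abs]; exact abs_le.2 ⟨by linarith [hx.1], hx.2⟩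
        have hinv' : 0 < (invTau c ((tsys P.d (L * domCount P M (k + 1))).dj Y))⁻¹ := inv_pos.2 (hposY Y)
        calc ‖w‖ = ‖(w - (x : ℂ)) + (x : ℂ)‖ := by rw [sub_add_cancel]
          _ ≤ ‖w - (x : ℂ)‖ + ‖(x : ℂ)‖ := norm_add_le _ _
          _ ≤ 1 + 1 := add_le_add (by rw [← dist_eq_norm]; exact hw) hx1
          _ < (invTau c ((tsys P.d (L * domCount P M (k + 1))).dj Y))⁻¹ + 3 := by linarith,
      hχ0 := fun _ => by simp only [hχ, zero_le_one],
      hχc0 := fun _ => by simp only [hχc, zero_le_one],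
      hχm := by simpa only [hχ] using measurable_const,
      hχcm := by simpa only [hχc] using measurable_const,
      h222 := fun B => by
        simp only [hχ, hχc, hP0, Nat.cast_zero, mul_zero, neg_zero, zero_add, one_mul]
        refine Real.one_le_exp (mul_nonneg (by norm_num) ?_)
        show (0 : ℝ) ≤ ∑ i, B i * B i
        exact Finset.sum_nonneg fun i _ => mul_self_nonneg (B i),
      hγ₂ := by norm_num,
      hqP := fun _ => le_rfl,
      hAhol := fun _ _ i j => by simp only [hA1]; exact differentiableOn_const _,
      hGhol := fun _ _ i j => by simp only [hG0]; exact differentiableOn_const _,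
      hAd := fun σ _ i j => by simp only [hA1]; exact differentiableOn_const _,
      hGd := fun σ _ i j => by simp only [hG0]; exact differentiableOn_const _,
      hAs := fun _ _ σ _ => by rw [hA1]; exact Matrix.isSymm_one,
      hfibN := fun x => (Finset.card_filter_le _ _).trans (by rw [Finset.card_univ, hcardΛC, hm]),
      hkap'' := by norm_num,
      hk1 := by norm_num,
      hk2 := by norm_num,
      hθE := le_rfl,
      hθΓ := le_rfl,
      hθC := le_rfl,
      hKG := le_rfl,
      hKΓ := le_rfl,
      hKCs := zero_le_one,
      hK₀ := zero_le_one,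
      hKE := zero_le_one,
      hG := fun _ _ σ _ b j => by rw [hG0, Matrix.zero_apply, norm_zero, zero_mul],
      hΓ₀ := fun b j => by rw [hΓ0, Matrix.zero_apply, norm_zero, zero_mul],
      hCs := fun _ _ σ _ b b' => by
        rw [hA1, inv_one]
        by_cases hb : b = b'
        · subst hb; rw [Matrix.one_apply_eq, norm_one, tdist1_self, mul_zero, neg_zero, Real.exp_zero, mul_one]
        · rw [Matrix.one_apply_ne hb, norm_zero]; positivity,
      hC216 := fun b b' => by
        rw [hC1]
        by_cases hb : b = b'
        · subst hb; rw [Matrix.one_apply_eq, norm_one, tdist1_self, mul_zero, neg_zero, Real.exp_zero, mul_one]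
        · rw [Matrix.one_apply_ne hb, norm_zero]; positivity,
      hCE := fun b b' => by
        rw [hC1, inv_one, Matrix.map_one _ (map_zero _) (map_one _)]
        by_cases hb : b = b'
        · subst hb; rw [Matrix.one_apply_eq, norm_one, tdist1_self, mul_zero, neg_zero, Real.exp_zero, mul_one]
        · rw [Matrix.one_apply_ne hb, norm_zero]; positivity,
      hdΓ := fun _ _ σ _ b j => by rw [hG0, hΓ0, Matrix.map_zero _ (map_zero _), sub_zero, Matrix.zero_apply, norm_zero, zero_mul],
      hdC := fun _ _ σ _ b b' => by rw [hA1, hC1, inv_one, Matrix.map_one _ (map_zero _) (map_one _), sub_self, Matrix.zero_apply, norm_zero, zero_mul],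
      hdE := fun _ _ σ _ b b' => by rw [hA1, hC1, inv_one, Matrix.map_one _ (map_zero _) (map_one _), sub_self, Matrix.zero_apply, norm_zero, zero_mul],
      hKG' := by norm_num,
      hKCs' := by norm_num,
      hθΓ' := by norm_num,
      hθC' := by norm_num,
      hθE' := by norm_num,
      hθEle := by norm_num,
      hθΓle := by norm_num,
      hθR1le := by simp only [hpow, hm, Nat.cast_one, mul_one]; norm_num,
      hsmallKθ := by simp only [hpow, hm, Nat.cast_one, mul_one]; norm_num,
      hc0 := zero_le_one,
      hc := fun i => by
        haveI : Nonempty (𝔇.𝒦 Z t).Λ := ⟨i⟩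
        have h : (𝔇.𝒦 Z t).hC.1.eigenvalues i ∈ spectrum ℝ (1 : Matrix (𝔇.𝒦 Z t).Λ (𝔇.𝒦 Z t).Λ ℝ) := by
          have h0 := (𝔇.𝒦 Z t).hC.1.eigenvalues_mem_spectrum_real i
          rwa [show spectrum ℝ (𝔇.𝒦 Z t).C = spectrum ℝ (1 : Matrix (𝔇.𝒦 Z t).Λ (𝔇.𝒦 Z t).Λ ℝ) by rw [hC1]] at h0
        rw [spectrum.one_eq, Set.mem_singleton_iff] at h
        exact h.le,
      hαc := by simp only [hpow, hm, Nat.cast_one, mul_one]; norm_num,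
      hg := le_rfl,
      hΓq := fun X => by rw [hΓ0, Matrix.zero_mulVec, zero_dotProduct, zero_mul],
      hsmall := by simp only [hpow, hm, Nat.cast_one, mul_one]; norm_num,
      hPa := by rw [hrPsq]; nlinarith [le_max_left a 0, le_max_right a 0],
      hvol := by
        have h1 : (1 : ℝ) ≤ ((Z.1).card : ℝ) := Nat.one_le_cast.mpr hZ
        simp only [hpow, hm, hcardΛ, hcardΛC, Nat.cast_one, mul_one, one_mul]
        nlinarith [h1],
      hχe := fun _ => by simp only [hχ],
      hχce := fun _ => by simp only [hχc],
      hαc_c := by simp only [hpow, hm, Nat.cast_one, mul_one]; norm_num,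
      hsmall_c := by simp only [hpow, hm, Nat.cast_one, mul_one]; norm_num,
      hvol_c := by
        have h1 : (1 : ℝ) ≤ ((Z.1).card : ℝ) := Nat.one_le_cast.mpr hZ
        simp only [hpow, hm, hcardΛ, hcardΛC, Nat.cast_one, mul_one, one_mul]
        nlinarith [h1],
      hχ1 := fun _ _ => by simp only [hχ, hχc, one_mul, le_refl],
      hκ := by norm_num,
      hboxR := fun _ _ _ => by simp only [hχ, hχc, one_mul],
      ha₀ := le_rfl,
      hαc_b := by simp only [hpow, hm, Nat.cast_one, mul_one]; norm_num,
      hsmall_b := by simp only [hpow, hm, Nat.cast_one, mul_one]; norm_num,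
      hvol_b := by
        have h1 : (1 : ℝ) ≤ ((Z.1).card : ℝ) := Nat.one_le_cast.mpr hZ
        simp only [hpow, hm, hcardΛ, hcardΛC, Nat.cast_one, mul_one, one_mul]
        nlinarith [h1],
      hα₀ := le_rfl,
      hαc_f := by simp only [hpow, hm, Nat.cast_one, mul_one]; norm_num,
      hsmall_f := by simp only [hpow, hm, Nat.cast_one, mul_one]; norm_num,
      hr₁ := fun h => absurd hP h,
      hPa1 := fun h => absurd hP h,
      hA := fun _ _ σ _ => by rw [hA1, Matrix.map_one _ Complex.zero_re Complex.one_re]; exact Matrix.PosDef.one,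
      hθEle0 := by norm_num,
      hθΓle0 := by norm_num,
      hθR1le0 := by simp only [hpow, hm, Nat.cast_one, mul_one]; norm_num,
      hαc_0 := by simp only [hpow, hm, Nat.cast_one, mul_one]; norm_num,
      hsmall_0 := by simp only [hpow, hm, Nat.cast_one, mul_one]; norm_num,
      hvol_0 := by
        have h1 : (1 : ℝ) ≤ ((Z.1).card : ℝ) := Nat.one_le_cast.mpr hZ
        simp only [hpow, hm, hcardΛ, hcardΛC, Nat.cast_one, mul_one, one_mul]
        nlinarith [h1],
      hRb := fun _ => by
        rw [hRbsq]
        have : -(1 / 100 / 2 * (200 * y)) = -y := by ring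
        rw [this]
        exact hrate,
      hTP := fun h => absurd hP h,
      hMvT := fun _ => by linarith,
      hMvP := fun h => absurd hP h,
      𝒲₃ := fun _ _ => 0,
      D𝒪 := fun _ _ _ => 0,
      ρ := 1,
      hρ := zero_lt_one,
      h𝒲m := fun _ _ Y => by simpa only [h𝒲] using measurable_const,
      h𝒲d := fun _ _ => by simpa only [h𝒲] using differentiableOn_const (0 : ℂ),
      h𝒲₃m := fun _ => measurable_const,
      h𝒲₃ := fun _ _ _ => by rw [mul_zero],
      R := fun Y => (invTau c ((tsys P.d (L * domCount P M (k + 1))).dj Y))⁻¹ + 3,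
      c₀ := fun _ => 0,
      c₃ := fun _ => 0,
      c₃' := fun _ => 0,
      c₄ := fun _ => 0,
      c₁ := fun _ => 0,
      c₁' := fun _ => 0,
      c₂ := fun _ => 0,
      hR := fun Y _ => by have := inv_pos.2 (hposY Y); linarith,
      hc₃ := fun _ _ => le_rfl,
      hc₃' := fun _ _ => le_rfl,
      hc₄ := fun _ _ => le_rfl,
      hc₁ := fun _ _ => le_rfl,
      hc₁' := fun _ _ => le_rfl,
      hc₂ := fun _ _ => le_rfl,
      hUτR := fun Y _ w hw => by rw [mem_ball, dist_zero_right] at hw; exact hw.le,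
      h1 := fun _ _ _ _ _ _ => by simp only [h𝒲, norm_zero, zero_mul, le_refl],
      S := fun _ => ∅,
      h1loc := fun _ _ _ _ _ _ => by simp only [h𝒲, norm_zero, zero_mul, le_refl],
      cubeOf := fun _ _ => 0,
      hS := fun _ _ b hb => absurd hb (Finset.notMem_empty _),
      Cp := 0,
      κp := B12TreeDecay.kappa₀ (4 * 2 ^ P.d) (2 * P.d),
      hCp := le_rfl,
      hκp := le_rfl,
      hdecay := fun _ _ => by rw [mul_zero, zero_mul],
      h2 := fun _ _ _ _ _ _ => by simp only [h𝒲, sub_zero, norm_zero, zero_mul, le_refl],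
      h3 := fun _ _ _ => by rw [norm_zero, zero_mul],
      S₀ := ∅,
      hbox := fun _ _ b hb => absurd hb (Set.notMem_empty _),
      hloc𝒲 := fun _ _ _ _ _ _ _ => by simp only [h𝒲],
      δ := 1 / 400,
      hδ := by norm_num,
      h𝒪m := fun _ _ _ _ Y => by simpa only [h𝒪] using measurable_const,
      h𝒪d := fun _ _ _ _ => by simpa only [h𝒪] using differentiableOn_const (0 : ℂ),
      hD𝒪m := fun _ _ _ => measurable_const,
      hD𝒪 := fun _ _ _ _ _ => by rw [mul_zero],
      h0 := fun _ _ _ _ _ _ => by simp only [h𝒪, norm_zero, le_refl],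
      h4 := fun _ _ _ _ _ _ _ _ => by simp only [h𝒪, sub_zero, norm_zero, zero_mul, le_refl],
      h5 := fun _ _ _ _ _ _ _ _ => by simp only [h𝒪, sub_zero, norm_zero, zero_mul, le_refl],
      h6 := fun _ _ _ _ _ => by rw [norm_zero, zero_mul],
      hloc𝒪 := fun _ _ _ _ _ _ _ _ _ => by simp only [h𝒪],
      hOhol := fun _ _ O _ cv _ _ Y A => by simpa only [h𝒪] using differentiableOn_const (0 : ℂ),
      ha' := by norm_num,
      hw' := by simp,
      hac := by norm_num,
      hwc := by simp,
      hw₀ := by simp }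

end YMDAG.N22.W1

end
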